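import Literature.NumberTheory.EllipticCurves.BinaryQuarticTwoCoveringsSelmerMap
import HarnessLib

/-!
# Two-coverings attached to binary quartic forms, VI: forms with the same class are equivalent

Topic `Literature/NumberTheory/EllipticCurves`. Sixth file of the theory proving the named fact
`Literature.NumberTheory.EllipticCurves.bhargavaShankar_card_selmerTwo_eq_kEquivClassCount`
(`BinaryQuarticMinimisation.lean`; Bhargava–Shankar 2015, held arXiv text §5.1, Lemma 5.2).

**Injectivity** of the map "form `↦` Selmer class" on `ℚ`-equivalence classes (Cremona 2001,
Prop. 3.2 (2) "⇐": quartics with the same invariants and the same cubic seminvariant class are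
`GL(2, K)`-equivalent; Bhargava–Shankar Lemma 5.2: "the `2`-coverings … are isomorphic if and only
if `F₁` and `F₂` are equivalent"). We follow Cremona's proof, replacing the cubic seminvariant by
the torsor labels of file I: if `[f] = [g]` in `H¹(ℚ, E_{A,B}[2])` then

1. (`§1`) the `2`-torsion points of `E_{A,B}` are `O` and the three `T(r₀, r_k)` (the torsion
   abscissae are all the roots of `X³ + AX + B`), so the relation
   `T_g(s₀, σs₀) − T_f(r₀, σr₀) = σT₀ − T₀` defines a bijection `β : rᵢ ↦ s_{π i}` of the roots by
   `T_g(s₀, β u) = T_f(r₀, u) + T₀`; it is Galois-equivariant and preserves labels,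
   `T_g(βu, βv) = T_f(u, v)` (`§4`);
2. (`§2`) hence the roots have the same cross-ratio ("the cross-ratio of the roots … is
   `(φ − φ″)/(φ′ − φ″)`", Cremona 2001, p. 77), so there is `M ∈ GL₂(ℚ̄)`, explicit, with
   `M(rᵢ) = β(rᵢ)` for all four `i`;
3. (`§3`) `σ(M)` and `M` agree on three points, so `σ(M) ∝ M` ("by uniqueness of `A` up to
   scalar multiple, we have `A^σ = A`", loc. cit.), and after normalising an entry `M ∈ GL₂(ℚ)`;
4. (`§5`) `g` and `γ · f` have the same roots, so `g = κ(γ · f)`, and comparing labels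
   (`T_g = T_{γ·f}`, file IV) `κ = (t_g/(det γ · t_f))²` is a square: `g ∼ f`.

Main results: `TwoCovering.kEquiv_of_selmerClass_eq` (rational forms with `a ≠ 0`) and
`TwoCovering.kEquiv_of_selmerClassOf_eq` (members of `selmerFormSet AB`, file V).

## References

* J. E. Cremona, *Classical invariants and 2-descent on elliptic curves*, J. Symbolic Comput. 31
  (2001) 71–87, §3 p. 77 and Prop. 3.2 (2) with its proof. [Cremona2001]
* M. Bhargava, A. Shankar, Ann. of Math. (2) 181 (2015), §5.1 of arXiv:1006.1002v2, Lemma 5.2.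
  [BhargavaShankarAnnals2015]
-/

noncomputable section

open scoped Classical

universe u

namespace Literature.NumberTheory.EllipticCurves

namespace TwoCovering

open BinaryQuartic WeierstrassCurve WeierstrassCurve.Affine GaloisRepresentations

/-! ## §1 The `2`-torsion of `E_{A,B}` and the roots -/

section TwoTorsion

variable {F : Type*} [Field F] {C : Affine F} {A B : F}

/-- On a short model in characteristic `≠ 2`, a point `P` with `P + P = O` is `O` or a point
`(x, 0)`. [folklore] -/
theorem IsShortModel.eq_zero_or_eq_some_of_add_self (hC : IsShortModel C A B) (h2 : (2 : F) ≠ 0)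
    (P : C.Point) (hP : P + P = 0) : P = 0 ∨ ∃ (x : F) (hx : C.Nonsingular x 0), P = .some x 0 hx := by
  rcases P with _ | ⟨x, y, h⟩
  · exact Or.inl rfl
  · right
    have hy : y = C.negY x y := by
      by_contra hne
      rw [Point.add_self_of_Y_ne hne] at hP
      exact Point.some_ne_zero _ hP
    rw [hC.negY] at hy
    have hy0 : y = 0 := by
      have : 2 * y = 0 := by linear_combination hy
      exact (mul_eq_zero.mp this).resolve_left h2
    subst hy0
    exact ⟨x, h, rfl⟩

variable {f : BinaryQuartic F} (R : RootData f) {t : F} (hC : IsShortModel C A B)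
include hC

omit hC in
/-- **The torsion abscissae are all the roots of `X³ + AX + B`**: if `x³ + Ax + B = 0` then `x`
is one of `x(r₀, r₁), x(r₀, r₂), x(r₀, r₃)` (the three are distinct roots of the cubic, whose
elementary symmetric functions are `0, A, −B`). [folklore] -/
theorem eq_torsX_of_cubic (h3 : (3 : F) ≠ 0) (ht : t ≠ 0)
    (hI : f.I = -3 * A * t ^ 4) (hJ : f.J = -27 * B * t ^ 6) {x : F} (hx : x ^ 3 + A * x + B = 0) :
    x = torsX f t (R.r 0) (R.r 1) ∨ x = torsX f t (R.r 0) (R.r 2) ∨ x = torsX f t (R.r 0) (R.r 3) := by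
  -- factor the cubic over the three torsion abscissae
  set e₁ := torsX f t (R.r 0) (R.r 1)
  set e₂ := torsX f t (R.r 0) (R.r 2)
  set e₃ := torsX f t (R.r 0) (R.r 3)
  have ht2 : (3 * t ^ 2) ≠ 0 := mul_ne_zero h3 (pow_ne_zero _ ht)
  have h27 : (27 : F) ≠ 0 := by
    have : (27 : F) = 3 * 3 * 3 := by norm_num
    rw [this]; exact mul_ne_zero (mul_ne_zero h3 h3) h3
  have hsum := phi_sum_ofRoots f.a R.r
  have hsum2 := phi_sum_mul_ofRoots f.a R.r
  have hprod : phi (ofRootVec f.a R.r) (R.r 0) (R.r 1) * phi (ofRootVec f.a R.r) (R.r 0) (R.r 2) *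
      phi (ofRootVec f.a R.r) (R.r 0) (R.r 3) = -(ofRootVec f.a R.r).J := by
    have h := resolvent_eq_ofRoots f.a R.r 0
    linear_combination -h
  rw [← R.eq_ofRoots] at hsum hsum2 hprod
  have hA : A = -f.I / (3 * t ^ 4) := by rw [hI]; field_simp
  have hB : B = -f.J / (27 * t ^ 6) := by rw [hJ]; field_simp
  have s1 : e₁ + e₂ + e₃ = 0 := by
    have : e₁ + e₂ + e₃ = -(phi f (R.r 0) (R.r 1) + phi f (R.r 0) (R.r 2) + phi f (R.r 0) (R.r 3)) /
        (3 * t ^ 2) := by simp only [e₁, e₂, e₃, torsX]; ring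
    rw [this, hsum, neg_zero, zero_div]
  have s2 : e₁ * e₂ + e₁ * e₃ + e₂ * e₃ = A := by
    have : e₁ * e₂ + e₁ * e₃ + e₂ * e₃ = (phi f (R.r 0) (R.r 1) * phi f (R.r 0) (R.r 2) +
        phi f (R.r 0) (R.r 1) * phi f (R.r 0) (R.r 3) + phi f (R.r 0) (R.r 2) * phi f (R.r 0) (R.r 3)) /
        (3 * t ^ 2) ^ 2 := by
      simp only [e₁, e₂, e₃, torsX]
      field_simp
    rw [this, hsum2, hA]
    field_simp
    try ring
  have s3 : e₁ * e₂ * e₃ = -B := by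
    have : e₁ * e₂ * e₃ = -(phi f (R.r 0) (R.r 1) * phi f (R.r 0) (R.r 2) * phi f (R.r 0) (R.r 3)) /
        (3 * t ^ 2) ^ 3 := by
      simp only [e₁, e₂, e₃, torsX]
      field_simp
    rw [this, hprod, hB]
    field_simp
    try ring
  have key : (x - e₁) * (x - e₂) * (x - e₃) = x ^ 3 + A * x + B := by
    have : (x - e₁) * (x - e₂) * (x - e₃) =
        x ^ 3 - (e₁ + e₂ + e₃) * x ^ 2 + (e₁ * e₂ + e₁ * e₃ + e₂ * e₃) * x - e₁ * e₂ * e₃ := by ring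
    rw [this, s1, s2, s3]; ring
  rw [hx] at key
  rcases mul_eq_zero.mp key with h12 | h3'
  · rcases mul_eq_zero.mp h12 with h1 | h2'
    · exact Or.inl (sub_eq_zero.mp h1)
    · exact Or.inr (Or.inl (sub_eq_zero.mp h2'))
  · exact Or.inr (Or.inr (sub_eq_zero.mp h3'))

/-- **Every `2`-torsion point is a torsor difference**: if `P + P = O` then
`P = T(r₀, r_k)` for some `k` (`k = 0` for `P = O`). [folklore] -/
theorem exists_eq_torsorPt (h2 : (2 : F) ≠ 0) (ha : f.a ≠ 0) (h3 : (3 : F) ≠ 0)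
    (hΔ : f.disc ≠ 0) (ht : t ≠ 0) (hI : f.I = -3 * A * t ^ 4) (hJ : f.J = -27 * B * t ^ 6)
    (P : C.Point) (hP : P + P = 0) : ∃ k : Fin 4, P = torsorPt C f t (R.r 0) (R.r k) := by
  rcases hC.eq_zero_or_eq_some_of_add_self h2 P hP with rfl | ⟨x, hx, rfl⟩
  · exact ⟨0, (torsorPt_self f t _).symm⟩
  · have hcub : x ^ 3 + A * x + B = 0 := ((hC.nonsingular_zero_iff x).mp hx).1
    rcases eq_torsX_of_cubic R h3 ht hI hJ hcub with h | h | h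
    · refine ⟨1, ?_⟩
      rw [torsorPt_eq_some hC R ha h3 hΔ ht hI hJ (show (0 : Fin 4) ≠ 1 by decide)]
      simp only [Point.some.injEq, and_true]; exact h
    · refine ⟨2, ?_⟩
      rw [torsorPt_eq_some hC R ha h3 hΔ ht hI hJ (show (0 : Fin 4) ≠ 2 by decide)]
      simp only [Point.some.injEq, and_true]; exact h
    · refine ⟨3, ?_⟩
      rw [torsorPt_eq_some hC R ha h3 hΔ ht hI hJ (show (0 : Fin 4) ≠ 3 by decide)]
      simp only [Point.some.injEq, and_true]; exact h

/-- **`k ↦ T(r₀, r_k)` is injective** (the three torsion abscissae are distinct and `O` is not an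
affine point). [folklore] -/
theorem torsorPt_zero_injective (ha : f.a ≠ 0) (h3 : (3 : F) ≠ 0) (hΔ : f.disc ≠ 0)
    (ht : t ≠ 0) (hI : f.I = -3 * A * t ^ 4) (hJ : f.J = -27 * B * t ^ 6) {k l : Fin 4}
    (h : torsorPt C f t (R.r 0) (R.r k) = torsorPt C f t (R.r 0) (R.r l)) : k = l := by
  have ht2 : (3 * t ^ 2) ≠ 0 := mul_ne_zero h3 (pow_ne_zero _ ht)
  by_contra hkl
  by_cases hk : k = 0
  · subst hk
    rw [torsorPt_self, torsorPt_eq_some hC R ha h3 hΔ ht hI hJ hkl] at h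
    exact Point.some_ne_zero _ h.symm
  by_cases hl : l = 0
  · subst hl
    rw [torsorPt_self, torsorPt_eq_some hC R ha h3 hΔ ht hI hJ (Ne.symm hk)] at h
    exact Point.some_ne_zero _ h
  rw [torsorPt_eq_some hC R ha h3 hΔ ht hI hJ (Ne.symm hk),
    torsorPt_eq_some hC R ha h3 hΔ ht hI hJ (Ne.symm hl)] at h
  simp only [Point.some.injEq, and_true] at h
  have hphi : phi f (R.r 0) (R.r k) = phi f (R.r 0) (R.r l) := by
    simpa [torsX, div_left_inj' ht2, neg_inj] using h
  have h12 := R.phi01_ne_phi02 ha h3 hΔ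
  have h13 := R.phi01_ne_phi03 ha h3 hΔ
  have h23 := R.phi02_ne_phi03 ha h3 hΔ
  fin_cases k <;> fin_cases l <;> first
    | exact absurd rfl hkl
    | exact absurd rfl hk
    | exact absurd rfl hl
    | exact h12 hphi
    | exact h12 hphi.symm
    | exact h13 hphi
    | exact h13 hphi.symm
    | exact h23 hphi
    | exact h23 hphi.symm

end TwoTorsion

/-! ## §2 A Möbius transformation through four points with the same cross-ratio -/

section Moebius

variable {F : Type*} [Field F]

/-- Entry `(0,0)` of the Möbius matrix through `rᵢ ↦ sᵢ` (`i = 0, 1, 2`). [folklore] -/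
def mob00 (r s : Fin 4 → F) : F :=
  -(r 0 * s 0 * s 1) + r 0 * s 0 * s 2 + r 1 * s 0 * s 1 - r 1 * s 1 * s 2 - r 2 * s 0 * s 2 + r 2 * s 1 * s 2

/-- Entry `(0,1)` of the Möbius matrix. [folklore] -/
def mob01 (r s : Fin 4 → F) : F :=
  -(r 0 * r 1 * s 0 * s 2) + r 0 * r 1 * s 1 * s 2 + r 0 * r 2 * s 0 * s 1 - r 0 * r 2 * s 1 * s 2 -
    r 1 * r 2 * s 0 * s 1 + r 1 * r 2 * s 0 * s 2

/-- Entry `(1,0)` of the Möbius matrix. [folklore] -/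
def mob10 (r s : Fin 4 → F) : F :=
  -(r 0 * s 1) + r 0 * s 2 + r 1 * s 0 - r 1 * s 2 - r 2 * s 0 + r 2 * s 1

/-- Entry `(1,1)` of the Möbius matrix. [folklore] -/
def mob11 (r s : Fin 4 → F) : F :=
  -(r 0 * r 1 * s 0) + r 0 * r 1 * s 1 + r 0 * r 2 * s 0 - r 0 * r 2 * s 2 - r 1 * r 2 * s 1 + r 1 * r 2 * s 2

/-- **The Möbius transformation through `rᵢ ↦ sᵢ`** (`i = 0, 1, 2`): the matrix
`adj(N_s) · N_r`, `N_x = ((x₁−x₂), −x₀(x₁−x₂); (x₁−x₀), −x₂(x₁−x₀))` the matrix sending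
`x₀, x₁, x₂ ↦ 0, 1, ∞`, written out; it acts on `x` by `x ↦ (m₀₀x + m₀₁)/(m₁₀x + m₁₁)`.
[folklore] -/
def moebiusMatrix (r s : Fin 4 → F) : Matrix (Fin 2) (Fin 2) F :=
  !![mob00 r s, mob01 r s; mob10 r s, mob11 r s]

/-- Entries of the Möbius matrix (definitional). [folklore] -/
@[simp] theorem moebiusMatrix_apply_00 (r s : Fin 4 → F) : moebiusMatrix r s 0 0 = mob00 r s := rfl
/-- Entries of the Möbius matrix (definitional). [folklore] -/
@[simp] theorem moebiusMatrix_apply_01 (r s : Fin 4 → F) : moebiusMatrix r s 0 1 = mob01 r s := rfl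
/-- Entries of the Möbius matrix (definitional). [folklore] -/
@[simp] theorem moebiusMatrix_apply_10 (r s : Fin 4 → F) : moebiusMatrix r s 1 0 = mob10 r s := rfl
/-- Entries of the Möbius matrix (definitional). [folklore] -/
@[simp] theorem moebiusMatrix_apply_11 (r s : Fin 4 → F) : moebiusMatrix r s 1 1 = mob11 r s := rfl

/-- The determinant of the Möbius matrix is the product of the root differences. [folklore] -/
theorem det_moebiusMatrix (r s : Fin 4 → F) : (moebiusMatrix r s).det =
    (r 0 - r 1) * (r 0 - r 2) * (r 1 - r 2) * ((s 0 - s 1) * (s 0 - s 2) * (s 1 - s 2)) := by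
  rw [moebiusMatrix, Matrix.det_fin_two_of]
  simp only [mob00, mob01, mob10, mob11]
  ring

/-- The Möbius matrix maps `r₀ ↦ s₀`: numerator `= c₀ s₀`, denominator `= c₀` with
`c₀ = −(r₀ − r₁)(r₀ − r₂)(s₁ − s₂)`. [folklore] -/
theorem moebius_apply_zero (r s : Fin 4 → F) :
    mob00 r s * r 0 + mob01 r s = -((r 0 - r 1) * (r 0 - r 2) * (s 1 - s 2)) * s 0 ∧
      mob10 r s * r 0 + mob11 r s = -((r 0 - r 1) * (r 0 - r 2) * (s 1 - s 2)) := by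
  constructor <;> simp only [mob00, mob01, mob10, mob11] <;> ring

/-- The Möbius matrix maps `r₁ ↦ s₁`. [folklore] -/
theorem moebius_apply_one (r s : Fin 4 → F) :
    mob00 r s * r 1 + mob01 r s = -((r 0 - r 1) * (r 1 - r 2) * (s 0 - s 2)) * s 1 ∧
      mob10 r s * r 1 + mob11 r s = -((r 0 - r 1) * (r 1 - r 2) * (s 0 - s 2)) := by
  constructor <;> simp only [mob00, mob01, mob10, mob11] <;> ring

/-- The Möbius matrix maps `r₂ ↦ s₂`. [folklore] -/
theorem moebius_apply_two (r s : Fin 4 → F) :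
    mob00 r s * r 2 + mob01 r s = -((r 0 - r 2) * (r 1 - r 2) * (s 0 - s 1)) * s 2 ∧
      mob10 r s * r 2 + mob11 r s = -((r 0 - r 2) * (r 1 - r 2) * (s 0 - s 1)) := by
  constructor <;> simp only [mob00, mob01, mob10, mob11] <;> ring

/-- **The fourth point**: the Möbius matrix maps `r₃ ↦ s₃` exactly when the cross-ratios agree:
`(m₀₀r₃ + m₀₁) − s₃(m₁₀r₃ + m₁₁) = (r₃−r₀)(r₁−r₂)(s₃−s₂)(s₁−s₀) − (s₃−s₀)(s₁−s₂)(r₃−r₂)(r₁−r₀)`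
(Cremona 2001, §3 p. 77 and proof of Prop. 3.2 (2): equal cross-ratios give "a matrix
`A ∈ GL(2, M)`, uniquely determined up to scalar multiple, such that `A(xᵢ) = yᵢ`").
[cite: Cremona2001, proof of Prop. 3.2 (2)] -/
theorem moebius_apply_three_sub (r s : Fin 4 → F) :
    (mob00 r s * r 3 + mob01 r s) - s 3 * (mob10 r s * r 3 + mob11 r s) =
      (r 3 - r 0) * (r 1 - r 2) * (s 3 - s 2) * (s 1 - s 0) - (s 3 - s 0) * (s 1 - s 2) * (r 3 - r 2) * (r 1 - r 0) := by
  simp only [mob00, mob01, mob10, mob11]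
  ring

/-- A nonsingular `2 × 2` matrix has no kernel vector `(x, 1)ᵀ`: if the numerator is `s` times the
denominator then the denominator is nonzero. [folklore] -/
theorem den_ne_zero_of_det_ne_zero {M : Matrix (Fin 2) (Fin 2) F} (hM : M.det ≠ 0) (x s : F)
    (h : M 0 0 * x + M 0 1 = s * (M 1 0 * x + M 1 1)) : M 1 0 * x + M 1 1 ≠ 0 := by
  intro h1
  apply hM
  rw [Matrix.det_fin_two]
  rw [h1, mul_zero] at h
  have h01 : M 0 1 = -(M 0 0 * x) := by linear_combination h
  have h11 : M 1 1 = -(M 1 0 * x) := by linear_combination h1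
  rw [h01, h11]; ring

end Moebius

/-! ## §3 Projective agreement on three points forces proportionality -/

section Proportional

variable {F : Type*} [Field F]

/-- A binary quadratic form `αX² + βX + γ` (in `(X, 1)`) vanishing at three distinct points is zero.
[folklore] -/
theorem quadratic_eq_zero_of_three_roots {α β γ : F} {x₀ x₁ x₂ : F} (h01 : x₀ ≠ x₁) (h02 : x₀ ≠ x₂)
    (h12 : x₁ ≠ x₂) (h0 : α * x₀ ^ 2 + β * x₀ + γ = 0) (h1 : α * x₁ ^ 2 + β * x₁ + γ = 0)
    (h2 : α * x₂ ^ 2 + β * x₂ + γ = 0) : α = 0 ∧ β = 0 ∧ γ = 0 := by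
  have hα : α * ((x₀ - x₁) * (x₀ - x₂) * (x₁ - x₂)) = 0 := by
    linear_combination (x₁ - x₂) * h0 - (x₀ - x₂) * h1 + (x₀ - x₁) * h2
  have hα0 : α = 0 := (mul_eq_zero.mp hα).resolve_right
    (mul_ne_zero (mul_ne_zero (sub_ne_zero.mpr h01) (sub_ne_zero.mpr h02)) (sub_ne_zero.mpr h12))
  have hβ : β * (x₀ - x₁) = 0 := by linear_combination h0 - h1 - (x₀ ^ 2 - x₁ ^ 2) * hα0
  have hβ0 : β = 0 := (mul_eq_zero.mp hβ).resolve_right (sub_ne_zero.mpr h01)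
  refine ⟨hα0, hβ0, ?_⟩
  linear_combination h0 - x₀ ^ 2 * hα0 - x₀ * hβ0

/-- **Two nonsingular `2 × 2` matrices that agree projectively on three distinct points `(xᵢ, 1)ᵀ`
are proportional** ("by uniqueness of `A` up to scalar multiple", Cremona 2001, proof of
Prop. 3.2 (2)): if `M'(xᵢ) = cᵢ M(xᵢ)` on numerators and denominators for `i = 0, 1, 2` then
`M' = a M`. [cite: Cremona2001, proof of Prop. 3.2 (2) (uniqueness of A up to scalars)] -/
theorem exists_eq_smul_of_agree {M M' : Matrix (Fin 2) (Fin 2) F} (hM : M.det ≠ 0) {x : Fin 3 → F}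
    (hx : Function.Injective x) (c : Fin 3 → F)
    (hn : ∀ i, M' 0 0 * x i + M' 0 1 = c i * (M 0 0 * x i + M 0 1))
    (hd : ∀ i, M' 1 0 * x i + M' 1 1 = c i * (M 1 0 * x i + M 1 1)) :
    ∃ a : F, M' = a • M := by
  -- eliminate the `cᵢ`: a quadratic relation at each `xᵢ`
  have hq : ∀ i, (M' 0 0 * M 1 0 - M' 1 0 * M 0 0) * x i ^ 2 +
      (M' 0 0 * M 1 1 + M' 0 1 * M 1 0 - M' 1 0 * M 0 1 - M' 1 1 * M 0 0) * x i +
      (M' 0 1 * M 1 1 - M' 1 1 * M 0 1) = 0 := fun i ↦ by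
    linear_combination (M 1 0 * x i + M 1 1) * hn i - (M 0 0 * x i + M 0 1) * hd i
  obtain ⟨hI, hII, hIII⟩ := quadratic_eq_zero_of_three_roots (hx.ne (by decide : (0 : Fin 3) ≠ 1))
    (hx.ne (by decide : (0 : Fin 3) ≠ 2)) (hx.ne (by decide : (1 : Fin 3) ≠ 2)) (hq 0) (hq 1) (hq 2)
  rw [Matrix.det_fin_two] at hM
  set a := (M 1 1 * M' 0 0 - M 0 1 * M' 1 0) / (M 0 0 * M 1 1 - M 0 1 * M 1 0) with ha
  have e00 : M' 0 0 = a * M 0 0 := by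
    rw [ha, div_mul_eq_mul_div, eq_div_iff hM]; linear_combination (-M 0 1) * hI
  have e01 : M' 0 1 = a * M 0 1 := by
    rw [ha, div_mul_eq_mul_div, eq_div_iff hM]; linear_combination (-M 0 1) * hII + M 0 0 * hIII
  have e10 : M' 1 0 = a * M 1 0 := by
    rw [ha, div_mul_eq_mul_div, eq_div_iff hM]; linear_combination (-M 1 1) * hI
  have e11 : M' 1 1 = a * M 1 1 := by
    rw [ha, div_mul_eq_mul_div, eq_div_iff hM]; linear_combination (-M 1 1) * hII + M 1 0 * hIII
  refine ⟨a, ?_⟩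
  ext i j
  fin_cases i <;> fin_cases j <;> simp only [Fin.zero_eta, Fin.mk_one, Fin.isValue, Matrix.smul_apply,
    smul_eq_mul] <;> [exact e00; exact e01; exact e10; exact e11]

end Proportional

/-! ## §4 From equal labels to the cross-ratio condition and the Möbius map -/

section Labels

variable {F : Type*} [Field F]

/-- **Equal labels force equal cross-ratios.** If the resolvent values of two root vectors satisfy
`φ_g(s₀, s_k) t_f² = φ_f(r₀, r_k) t_g²` (`k = 1, 2, 3`), then the cross-ratio condition of
`moebius_apply_three_sub` holds: the Möbius map through `r₀, r₁, r₂ ↦ s₀, s₁, s₂` also sends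
`r₃ ↦ s₃` ("the cross-ratio of the roots … is `(φ − φ″)/(φ′ − φ″)`", Cremona 2001, §3 p. 77).
[cite: Cremona2001, §3 p. 77 (cross-ratio of the roots)] -/
theorem crossRatio_condition (af ag tf tg : F) (r s : Fin 4 → F) (haf : af ≠ 0) (hag : ag ≠ 0)
    (htf : tf ≠ 0) (h3 : (3 : F) ≠ 0)
    (E1 : phi (ofRootVec ag s) (s 0) (s 1) * tf ^ 2 = phi (ofRootVec af r) (r 0) (r 1) * tg ^ 2)
    (E2 : phi (ofRootVec ag s) (s 0) (s 2) * tf ^ 2 = phi (ofRootVec af r) (r 0) (r 2) * tg ^ 2)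
    (E3 : phi (ofRootVec ag s) (s 0) (s 3) * tf ^ 2 = phi (ofRootVec af r) (r 0) (r 3) * tg ^ 2) :
    (r 3 - r 0) * (r 1 - r 2) * (s 3 - s 2) * (s 1 - s 0) - (s 3 - s 0) * (s 1 - s 2) * (r 3 - r 2) * (r 1 - r 0) = 0 := by
  -- `9 a_f a_g t_f² · CRC = (X₂−X₃)E₁ − (X₁−X₃)E₂ + (X₁−X₂)E₃` identically, `X_k = φ_f(r₀, r_k)`
  have key : (9 * af * ag * tf ^ 2) * ((r 3 - r 0) * (r 1 - r 2) * (s 3 - s 2) * (s 1 - s 0) -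
      (s 3 - s 0) * (s 1 - s 2) * (r 3 - r 2) * (r 1 - r 0)) = 0 := by
    simp only [phi, ofRootVec, ofRoots] at E1 E2 E3
    linear_combination
      ((3 * af * (r 0 + r 2) ^ 2 + 3 * (-af * (r 0 + r 1 + r 2 + r 3)) * (r 0 + r 2)) -
        (3 * af * (r 0 + r 3) ^ 2 + 3 * (-af * (r 0 + r 1 + r 2 + r 3)) * (r 0 + r 3))) * E1 -
      ((3 * af * (r 0 + r 1) ^ 2 + 3 * (-af * (r 0 + r 1 + r 2 + r 3)) * (r 0 + r 1)) -
        (3 * af * (r 0 + r 3) ^ 2 + 3 * (-af * (r 0 + r 1 + r 2 + r 3)) * (r 0 + r 3))) * E2 +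
      ((3 * af * (r 0 + r 1) ^ 2 + 3 * (-af * (r 0 + r 1 + r 2 + r 3)) * (r 0 + r 1)) -
        (3 * af * (r 0 + r 2) ^ 2 + 3 * (-af * (r 0 + r 1 + r 2 + r 3)) * (r 0 + r 2))) * E3
  have h9 : (9 : F) ≠ 0 := by
    have : (9 : F) = 3 * 3 := by norm_num
    rw [this]; exact mul_ne_zero h3 h3
  exact (mul_eq_zero.mp key).resolve_left
    (mul_ne_zero (mul_ne_zero (mul_ne_zero h9 haf) hag) (pow_ne_zero _ htf))

end Labels

/-! ## §5 The main theorem: equal Selmer classes force `ℚ`-equivalence -/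

section Main

open IsDedekindDomain NumberField

/-- If an affine point `(x, 0)` equals a torsor difference `T(u, v)` then `x` is the torsion
abscissa `x(u, v)` (unfolding the total function `torsorPt`). [folklore] -/
theorem torsX_eq_of_some_eq {F : Type*} [Field F] {C : Affine F} {f : BinaryQuartic F} {t u v x : F}
    {hx : C.Nonsingular x 0} (h : Point.some x 0 hx = torsorPt C f t u v) : x = torsX f t u v := by
  unfold torsorPt at h
  split_ifs at h with hc
  simp only [Point.some.injEq, and_true] at h
  exact h

/-- Elements of `F̄` fixed by `Gal(F̄/F)` lie in `F` (characteristic `0`; Mathlib's infinite Galois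
theory). [folklore] -/
theorem exists_algebraMap_eq_of_fixed (F : Type*) [Field F] [CharZero F] (x : AlgebraicClosure F)
    (hx : ∀ σ : AlgebraicClosure F ≃ₐ[F] AlgebraicClosure F, σ x = x) : ∃ q : F, algebraMap F _ q = x := by
  haveI : IsGalois F (AlgebraicClosure F) := {}
  exact (InfiniteGalois.mem_range_algebraMap_iff_fixed x).mpr hx

/-- `ofRootVec` is linear in the leading coefficient. [folklore] -/
theorem ofRootVec_mul {F : Type*} [Field F] (c a : F) (r : Fin 4 → F) :
    ofRootVec (c * a) r = c • ofRootVec a r := by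
  ext <;> simp only [ofRootVec, ofRoots, smul_a, smul_b, smul_c, smul_d, smul_e] <;> ring

/-- `φ` is linear in the form. [folklore] -/
theorem phi_smul {F : Type*} [Field F] (c : F) (f : BinaryQuartic F) (u v : F) :
    phi (c • f) u v = c * phi f u v := by
  simp only [phi, smul_a, smul_b, smul_c]; ring

/-- `BinaryQuartic.map` along an injective ring homomorphism is injective. [folklore] -/
theorem map_injective {R S : Type*} [CommRing R] [CommRing S] {ψ : R →+* S} (hψ : Function.Injective ψ) :
    Function.Injective (BinaryQuartic.map ψ) := by
  intro f g h
  have ha := congrArg BinaryQuartic.a h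
  have hb := congrArg BinaryQuartic.b h
  have hc := congrArg BinaryQuartic.c h
  have hd := congrArg BinaryQuartic.d h
  have he := congrArg BinaryQuartic.e h
  simp only [map_a, map_b, map_c, map_d, map_e] at ha hb hc hd he
  ext
  exacts [hψ ha, hψ hb, hψ hc, hψ hd, hψ he]

variable {AB : ℤ × ℤ} {f g : BinaryQuartic ℚ} {tf tg : ℚ}

/-- **Forms with the same Selmer class are `ℚ`-equivalent** (Cremona 2001, Prop. 3.2 (2) "⇐",
via torsor labels; Bhargava–Shankar, Lemma 5.2: the `2`-coverings given by `F₁`, `F₂` "are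
isomorphic if and only if `F₁` and `F₂` are equivalent"). For rational forms `f`, `g` in the
`E_{A,B}`-family (nonzero leading coefficients) and any roots `r₀`, `s₀`: if
`selmerClass f = selmerClass g` in `H¹(ℚ, E_{A,B}[2])` then `g = μ²(γ · f)` for some `μ ∈ ℚˣ`,
`γ ∈ GL₂(ℚ)`. [cite: Cremona2001, Prop. 3.2 (2)] -/
theorem kEquiv_of_selmerClass_eq (hf : Setup f (AB.1 : ℚ) (AB.2 : ℚ) tf)
    (hg : Setup g (AB.1 : ℚ) (AB.2 : ℚ) tg) {r₀ s₀ : AlgebraicClosure ℚ}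
    (hr₀ : (f.map (algebraMap ℚ (AlgebraicClosure ℚ))).eval r₀ 1 = 0)
    (hs₀ : (g.map (algebraMap ℚ (AlgebraicClosure ℚ))).eval s₀ 1 = 0)
    (heq : selmerClass hf hr₀ = selmerClass hg hs₀) : KEquiv f g := by
  -- notation
  set Ω := AlgebraicClosure ℚ
  set ι := algebraMap ℚ Ω with hι
  set W := shortWeierstrass AB
  set C := (W.baseChange Ω).toAffine with hCdef
  have hC : IsShortModel C (ι (AB.1 : ℚ)) (ι (AB.2 : ℚ)) := isShortModel_ratCast AB Ω
  set fΩ := f.map ι with hfΩ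
  set gΩ := g.map ι with hgΩ
  have hfΩ' := hf.map ι
  have hgΩ' := hg.map ι
  have h2 : (2 : Ω) ≠ 0 := by norm_num
  have h3 : (3 : Ω) ≠ 0 := by norm_num
  obtain ⟨R⟩ := RootData.nonempty (f := fΩ) hfΩ'.a_ne
  obtain ⟨S⟩ := RootData.nonempty (f := gΩ) hgΩ'.a_ne
  have hΔf : fΩ.disc ≠ 0 := hfΩ'.disc_ne_zero
  have hΔg : gΩ.disc ≠ 0 := hgΩ'.disc_ne_zero
  have hRinj := R.injective hΔf
  have hSinj := S.injective hΔg
  -- move the roots to `r 0`, `s 0`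
  have hr : fΩ.eval (R.r 0) 1 = 0 := R.eval_r 0
  have hs : gΩ.eval (S.r 0) 1 = 0 := S.eval_r 0
  rw [selmerClass_changeRoot hf hr hr₀, selmerClass_changeRoot hg hs hs₀] at heq
  -- Step 1: unpack the equality of classes: `T_g(s₀,σs₀) − T_f(r₀,σr₀) = σT₀ − T₀`
  have hsub : oneCocycleClass _ (selmerCocycle hg hs - selmerCocycle hf hr) = 0 := by
    rw [oneCocycleClass_sub, sub_eq_zero]; exact heq.symm
  obtain ⟨T₀, hT₀⟩ := (oneCocycleClass_eq_zero_iff _ _).mp hsub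
  set P₀ : C.Point := (T₀ : geomPoints W) with hP₀
  have hP₀2 : P₀ + P₀ = 0 := (mem_geomTorsion_two_iff W _).mp T₀.2
  -- the action of `σ` on points, and the cocycle relation in `C.Point`
  have hstar : ∀ σ : Ω ≃ₐ[ℚ] Ω, cocycleFun W g tg (S.r 0) σ - cocycleFun W f tf (R.r 0) σ =
      Point.map (σ : Ω →ₐ[ℚ] Ω) P₀ - P₀ := by
    intro σ
    exact congrArg (fun x : geomTorsion W 2 ↦ ((x : geomPoints W) : C.Point)) (hT₀ σ)
  -- abbreviations for the torsors
  set Tf : Fin 4 → Fin 4 → C.Point := fun k l ↦ torsorPt C fΩ (ι tf) (R.r k) (R.r l) with hTf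
  set Tg : Fin 4 → Fin 4 → C.Point := fun k l ↦ torsorPt C gΩ (ι tg) (S.r k) (S.r l) with hTg
  have chaslesF := fun i j k ↦ torsorPt_add_torsorPt hC R hfΩ'.a_ne h3 hΔf hfΩ'.t_ne hfΩ'.I_eq hfΩ'.J_eq i j k
  have chaslesG := fun i j k ↦ torsorPt_add_torsorPt hC S hgΩ'.a_ne h3 hΔg hgΩ'.t_ne hgΩ'.I_eq hgΩ'.J_eq i j k
  have hTf2 : ∀ k l, Tf k l + Tf k l = 0 := fun k l ↦ torsorPt_add_self hC _ _ _ _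
  have hTg2 : ∀ k l, Tg k l + Tg k l = 0 := fun k l ↦ torsorPt_add_self hC _ _ _ _
  have hnegP₀ : -P₀ = P₀ := by
    rw [neg_eq_iff_add_eq_zero, hP₀2]
  -- Step 2: the index bijection `π` with `T_g(s₀, s_{π k}) = T_f(r₀, r_k) + T₀`
  have hπex : ∀ k : Fin 4, ∃ l : Fin 4, Tg 0 l = Tf 0 k + P₀ := fun k ↦ by
    have h2tors : (Tf 0 k + P₀) + (Tf 0 k + P₀) = 0 := by
      have := hTf2 0 k
      rw [add_add_add_comm, this, hP₀2, add_zero]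
    obtain ⟨l, hl⟩ := exists_eq_torsorPt S hC h2 hgΩ'.a_ne h3 hΔg hgΩ'.t_ne hgΩ'.I_eq hgΩ'.J_eq _ h2tors
    exact ⟨l, hl.symm⟩
  choose π hπ using hπex
  have hπinj : Function.Injective π := by
    intro k l hkl
    have h := hπ k
    rw [hkl, hπ l] at h
    exact torsorPt_zero_injective R hC hfΩ'.a_ne h3 hΔf hfΩ'.t_ne hfΩ'.I_eq hfΩ'.J_eq
      (add_right_cancel h).symm
  have hπbij : Function.Bijective π := Finite.injective_iff_bijective.mp hπinj
  set σπ : Equiv.Perm (Fin 4) := Equiv.ofBijective π hπbij with hσπ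
  set S' := S.reindex σπ with hS'def
  have hS' : ∀ k, S'.r k = S.r (π k) := fun k ↦ rfl
  have hS'inj := S'.injective hΔg
  -- Step 3: labels are preserved: `T_g(s'_k, s'_l) = T_f(r_k, r_l)`
  have hlabel : ∀ k l, torsorPt C gΩ (ι tg) (S'.r k) (S'.r l) = Tf k l := by
    intro k l
    have h1 := chaslesG 0 (π k) (π l)
    rw [show torsorPt C gΩ (ι tg) (S.r 0) (S.r (π k)) = Tg 0 (π k) from rfl, hπ k,
      show torsorPt C gΩ (ι tg) (S.r 0) (S.r (π l)) = Tg 0 (π l) from rfl, hπ l] at h1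
    have h2 : Tf 0 k + Tf k l = Tf 0 l := chaslesF 0 k l
    -- `Tf 0 k + P₀ + X = Tf 0 l + P₀` and `Tf 0 k + Tf k l = Tf 0 l`
    have : torsorPt C gΩ (ι tg) (S.r (π k)) (S.r (π l)) = Tf k l := by
      have e1 : torsorPt C gΩ (ι tg) (S.r (π k)) (S.r (π l)) = Tf 0 l + P₀ - (Tf 0 k + P₀) := by
        rw [← h1]; abel
      rw [e1, ← h2]; abel
    exact this
  -- Step 3': the `x`-coordinates: `φ_g(s'₀, s'_k) t_f² = φ_f(r₀, r_k) t_g²`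
  have htf2 : (3 * ι tf ^ 2) ≠ 0 := mul_ne_zero h3 (pow_ne_zero _ hfΩ'.t_ne)
  have htg2 : (3 * ι tg ^ 2) ≠ 0 := mul_ne_zero h3 (pow_ne_zero _ hgΩ'.t_ne)
  have hE : ∀ k : Fin 4, k ≠ 0 →
      phi gΩ (S'.r 0) (S'.r k) * ι tf ^ 2 = phi fΩ (R.r 0) (R.r k) * ι tg ^ 2 := by
    intro k hk
    have h := hlabel 0 k
    rw [torsorPt_eq_some hC S' hgΩ'.a_ne h3 hΔg hgΩ'.t_ne hgΩ'.I_eq hgΩ'.J_eq hk.symm,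
      show Tf 0 k = torsorPt C fΩ (ι tf) (R.r 0) (R.r k) from rfl,
      torsorPt_eq_some hC R hfΩ'.a_ne h3 hΔf hfΩ'.t_ne hfΩ'.I_eq hfΩ'.J_eq hk.symm] at h
    simp only [Point.some.injEq, and_true] at h
    rw [torsX, torsX, div_eq_div_iff htg2 htf2] at h
    linear_combination (-1 / 3 : Ω) * h
  -- Step 4: Galois equivariance of `k ↦ π k`
  have hequiv : ∀ (σ : Ω ≃ₐ[ℚ] Ω) (k k' : Fin 4), σ (R.r k) = R.r k' → σ (S'.r k) = S'.r k' := by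
    intro σ k k' hk
    obtain ⟨j, hj⟩ := exists_eq_r S hg.a_ne (eval_apply_eq_zero σ (S.eval_r 0))
    obtain ⟨m, hm⟩ := exists_eq_r S hg.a_ne (eval_apply_eq_zero σ (S.eval_r (π k)))
    obtain ⟨i, hi⟩ := exists_eq_r R hf.a_ne (eval_apply_eq_zero σ (R.eval_r 0))
    -- `T_g(s₀, σ s'_k) = T_f(r₀, r_{k'}) + T₀`
    have key : Tg 0 m = Tf 0 k' + P₀ := by
      have c1 := chaslesG 0 j m
      have c2 := chaslesF 0 i k'
      have hmap := map_torsorPt_eq (W := W) (g := g) (t := tg) (σ : Ω →ₐ[ℚ] Ω) σ (fun _ ↦ rfl)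
        (S.r 0) (S.r (π k))
      rw [hj, hm, show torsorPt C gΩ (ι tg) (S.r 0) (S.r (π k)) = Tg 0 (π k) from rfl, hπ k,
        map_add, map_torsorPt_eq (W := W) (g := f) (t := tf) (σ : Ω →ₐ[ℚ] Ω) σ (fun _ ↦ rfl),
        hi, hk] at hmap
      have hst := hstar σ
      rw [cocycleFun_apply, cocycleFun_apply, hj, hi] at hst
      -- assemble: Tg 0 m = Tg 0 j + Tg j m, Tg j m = Tf i k' + σP₀, Tg 0 j = Tf 0 i + σP₀ - P₀
      have e : Tg 0 m = Tf 0 k' + (Point.map (σ : Ω →ₐ[ℚ] Ω) P₀ + Point.map (σ : Ω →ₐ[ℚ] Ω) P₀) - P₀ := by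
        rw [show Tg 0 m = torsorPt C gΩ (ι tg) (S.r 0) (S.r m) from rfl, ← c1, ← hmap,
          show torsorPt C gΩ (ι tg) (S.r 0) (S.r j) = torsorPt C fΩ (ι tf) (R.r 0) (R.r i) +
            (Point.map (σ : Ω →ₐ[ℚ] Ω) P₀ - P₀) from by rw [← hst]; abel,
          show Tf 0 k' = torsorPt C fΩ (ι tf) (R.r 0) (R.r k') from rfl, ← c2]
        abel
      rw [e, ← map_add, hP₀2, map_zero, add_zero, sub_eq_add_neg, hnegP₀]
    rw [hS' k, hm, hS' k']
    congr 1
    exact torsorPt_zero_injective S hC hgΩ'.a_ne h3 hΔg hgΩ'.t_ne hgΩ'.I_eq hgΩ'.J_eq (key.trans (hπ k').symm)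
  -- Step 5: the cross-ratio condition and the Möbius matrix
  have hCRC := crossRatio_condition fΩ.a gΩ.a (ι tf) (ι tg) R.r S'.r hfΩ'.a_ne hgΩ'.a_ne hfΩ'.t_ne h3
    (by rw [← S'.eq_ofRoots, ← R.eq_ofRoots]; exact hE 1 (by decide))
    (by rw [← S'.eq_ofRoots, ← R.eq_ofRoots]; exact hE 2 (by decide))
    (by rw [← S'.eq_ofRoots, ← R.eq_ofRoots]; exact hE 3 (by decide))
  set M := moebiusMatrix R.r S'.r with hMdef
  have hMdet : M.det ≠ 0 := by
    rw [hMdef, det_moebiusMatrix]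
    refine mul_ne_zero (mul_ne_zero (mul_ne_zero ?_ ?_) ?_) (mul_ne_zero (mul_ne_zero ?_ ?_) ?_) <;>
      rw [sub_ne_zero] <;> intro h
    · exact absurd (hRinj h) (by decide)
    · exact absurd (hRinj h) (by decide)
    · exact absurd (hRinj h) (by decide)
    · exact absurd (hS'inj h) (by decide)
    · exact absurd (hS'inj h) (by decide)
    · exact absurd (hS'inj h) (by decide)
  -- numerators and denominators: `M(r_k) = s'_k` projectively, for all four `k`
  have hdiff : ∀ {i j : Fin 4}, i ≠ j → R.r i - R.r j ≠ 0 := fun hij ↦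
    sub_ne_zero.mpr fun h ↦ hij (hRinj h)
  have hdiff' : ∀ {i j : Fin 4}, i ≠ j → S'.r i - S'.r j ≠ 0 := fun hij ↦
    sub_ne_zero.mpr fun h ↦ hij (hS'inj h)
  have hp0 : M 1 0 * R.r 0 + M 1 1 ≠ 0 ∧ M 0 0 * R.r 0 + M 0 1 = S'.r 0 * (M 1 0 * R.r 0 + M 1 1) := by
    obtain ⟨hn, hd⟩ := moebius_apply_zero R.r S'.r
    simp only [hMdef, moebiusMatrix_apply_00, moebiusMatrix_apply_01, moebiusMatrix_apply_10,
      moebiusMatrix_apply_11]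
    refine ⟨?_, by rw [hn, hd]; ring⟩
    rw [hd, neg_ne_zero]
    exact mul_ne_zero (mul_ne_zero (hdiff (by decide)) (hdiff (by decide))) (hdiff' (by decide))
  have hp1 : M 1 0 * R.r 1 + M 1 1 ≠ 0 ∧ M 0 0 * R.r 1 + M 0 1 = S'.r 1 * (M 1 0 * R.r 1 + M 1 1) := by
    obtain ⟨hn, hd⟩ := moebius_apply_one R.r S'.r
    simp only [hMdef, moebiusMatrix_apply_00, moebiusMatrix_apply_01, moebiusMatrix_apply_10,
      moebiusMatrix_apply_11]
    refine ⟨?_, by rw [hn, hd]; ring⟩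
    rw [hd, neg_ne_zero]
    exact mul_ne_zero (mul_ne_zero (hdiff (by decide)) (hdiff (by decide))) (hdiff' (by decide))
  have hp2 : M 1 0 * R.r 2 + M 1 1 ≠ 0 ∧ M 0 0 * R.r 2 + M 0 1 = S'.r 2 * (M 1 0 * R.r 2 + M 1 1) := by
    obtain ⟨hn, hd⟩ := moebius_apply_two R.r S'.r
    simp only [hMdef, moebiusMatrix_apply_00, moebiusMatrix_apply_01, moebiusMatrix_apply_10,
      moebiusMatrix_apply_11]
    refine ⟨?_, by rw [hn, hd]; ring⟩
    rw [hd, neg_ne_zero]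
    exact mul_ne_zero (mul_ne_zero (hdiff (by decide)) (hdiff (by decide))) (hdiff' (by decide))
  have hp3 : M 1 0 * R.r 3 + M 1 1 ≠ 0 ∧ M 0 0 * R.r 3 + M 0 1 = S'.r 3 * (M 1 0 * R.r 3 + M 1 1) := by
    have h3sub := moebius_apply_three_sub R.r S'.r
    rw [hCRC, sub_eq_zero] at h3sub
    simp only [hMdef, moebiusMatrix_apply_00, moebiusMatrix_apply_01, moebiusMatrix_apply_10,
      moebiusMatrix_apply_11]
    exact ⟨den_ne_zero_of_det_ne_zero (M := moebiusMatrix R.r S'.r) hMdet _ _ h3sub, h3sub⟩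
  have hproj : ∀ k : Fin 4, M 1 0 * R.r k + M 1 1 ≠ 0 ∧
      M 0 0 * R.r k + M 0 1 = S'.r k * (M 1 0 * R.r k + M 1 1) := by
    intro k
    fin_cases k <;> [exact hp0; exact hp1; exact hp2; exact hp3]
  -- Step 6: Galois descent of `M`: `σ(M) = a_σ M`
  have hfix : ∀ x : Ω, (∀ σ : Ω ≃ₐ[ℚ] Ω, σ x = x) → ∃ q : ℚ, ι q = x := fun x hx ↦
    exists_algebraMap_eq_of_fixed ℚ x hx
  have hscalar : ∀ σ : Ω ≃ₐ[ℚ] Ω, ∃ a : Ω, M.map σ = a • M := by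
    intro σ
    -- the images of `r₀, r₁, r₂`
    have himg : ∀ k : Fin 4, ∃ k' : Fin 4, σ (R.r k) = R.r k' := fun k ↦
      exists_eq_r R hf.a_ne (eval_apply_eq_zero σ (R.eval_r k))
    choose κ hκ using himg
    have hκinj : Function.Injective κ := fun k l hkl ↦ hRinj (σ.injective (by rw [hκ k, hκ l, hkl]))
    refine exists_eq_smul_of_agree hMdet (x := fun i : Fin 3 ↦ R.r (κ (Fin.castSucc i)))
      (fun i j hij ↦ Fin.castSucc_injective _ (hκinj (hRinj hij)))
      (fun i ↦ σ (M 1 0 * R.r (Fin.castSucc i) + M 1 1) / (M 1 0 * R.r (κ (Fin.castSucc i)) + M 1 1))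
      (fun i ↦ ?_) (fun i ↦ ?_)
    · obtain ⟨hden', hnum'⟩ := hproj (κ (Fin.castSucc i))
      obtain ⟨-, hnum⟩ := hproj (Fin.castSucc i)
      have h := congrArg σ hnum
      rw [map_add, map_mul, map_mul, map_add, map_mul, hκ, hequiv σ _ _ (hκ _)] at h
      simp only [Matrix.map_apply]
      rw [h, hnum']
      simp only [map_add, map_mul, hκ]
      rw [div_mul_eq_mul_div, eq_div_iff hden']
      ring
    · obtain ⟨hden', -⟩ := hproj (κ (Fin.castSucc i))
      simp only [Matrix.map_apply, map_add, map_mul, hκ]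
      rw [div_mul_cancel₀ _ hden']
  -- a nonzero entry in the bottom row
  obtain ⟨j₀, hj₀⟩ : ∃ j₀ : Fin 2, M 1 j₀ ≠ 0 := by
    by_contra hall
    push Not at hall
    apply (hproj 0).1
    rw [hall 0, hall 1, zero_mul, zero_add]
  set e := M 1 j₀ with he
  set N := e⁻¹ • M with hNdef
  have hNfix : ∀ (σ : Ω ≃ₐ[ℚ] Ω) (i j : Fin 2), σ (N i j) = N i j := by
    intro σ i j
    obtain ⟨a, ha⟩ := hscalar σ
    have hij : σ (M i j) = a * M i j := by
      have := congrFun (congrFun ha i) j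
      simpa [Matrix.map_apply] using this
    have h1 : σ e = a * e := by
      have := congrFun (congrFun ha 1) j₀
      simpa [Matrix.map_apply] using this
    have ha0 : a ≠ 0 := by
      rintro rfl
      rw [zero_mul, map_eq_zero] at h1
      exact hj₀ h1
    have hN : N i j = e⁻¹ * M i j := by simp [hNdef, Matrix.smul_apply]
    rw [hN, map_mul, map_inv₀, h1, hij, mul_inv,
      show a⁻¹ * e⁻¹ * (a * M i j) = (a⁻¹ * a) * (e⁻¹ * M i j) by ring, inv_mul_cancel₀ ha0, one_mul]
  have hNrat : ∀ i j : Fin 2, ∃ q : ℚ, ι q = N i j := fun i j ↦ hfix _ (fun σ ↦ hNfix σ i j)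
  choose q hq using hNrat
  set γ : Matrix (Fin 2) (Fin 2) ℚ := Matrix.of q with hγdef
  have hγN : γ.map ι = N := by ext i j; simp [hγdef, hq]
  have hNdet : N.det ≠ 0 := by
    rw [hNdef, Matrix.det_smul, Fintype.card_fin]
    exact mul_ne_zero (pow_ne_zero _ (inv_ne_zero hj₀)) hMdet
  have hγdet : γ.det ≠ 0 := by
    intro h0
    apply hNdet
    rw [← hγN, show γ.map ι = ι.mapMatrix γ from rfl, ← RingHom.map_det, h0, map_zero]
  -- projective properties of `N`
  have hprojN : ∀ k : Fin 4, N 1 0 * R.r k + N 1 1 ≠ 0 ∧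
      N 0 0 * R.r k + N 0 1 = S'.r k * (N 1 0 * R.r k + N 1 1) := by
    intro k
    obtain ⟨hd, hn⟩ := hproj k
    simp only [hNdef, Matrix.smul_apply, smul_eq_mul]
    refine ⟨?_, by linear_combination e⁻¹ * hn⟩
    rw [show e⁻¹ * M 1 0 * R.r k + e⁻¹ * M 1 1 = e⁻¹ * (M 1 0 * R.r k + M 1 1) by ring]
    exact mul_ne_zero (inv_ne_zero hj₀) hd
  -- Step 7: the substitution `γ'` with `substRoot γ' r_k = s'_k`
  set γ' : Matrix (Fin 2) (Fin 2) ℚ := !![γ 1 1, -γ 1 0; -γ 0 1, γ 0 0] with hγ'def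
  set δ : Matrix (Fin 2) (Fin 2) Ω := γ'.map ι with hδdef
  have hδ : δ = !![N 1 1, -N 1 0; -N 0 1, N 0 0] := by
    rw [hδdef, ← hγN]
    ext i j; fin_cases i <;> fin_cases j <;> simp [hγ'def]
  have hγ'det : γ'.det ≠ 0 := by
    rw [hγ'def, Matrix.det_fin_two_of]
    rw [Matrix.det_fin_two] at hγdet
    intro h; apply hγdet; linear_combination h
  have hδden : ∀ k, δ 0 0 - R.r k * δ 0 1 ≠ 0 := fun k ↦ by
    rw [hδ]; simp
    rw [show N 1 1 - R.r k * -N 1 0 = N 1 0 * R.r k + N 1 1 by ring]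
    exact (hprojN k).1
  have hroot : ∀ k, substRoot δ (R.r k) = S'.r k := fun k ↦ by
    obtain ⟨hd, hn⟩ := hprojN k
    rw [substRoot, hδ]
    simp
    rw [div_eq_iff (by rw [show N 1 1 - R.r k * -N 1 0 = N 1 0 * R.r k + N 1 1 by ring]; exact hd)]
    linear_combination hn
  -- the transformed form and its root data
  have hmapf' : ((1 : ℚ) ^ 2 • f.subst γ').map ι = (1 : Ω) ^ 2 • fΩ.subst δ := by
    rw [map_smul_subst, map_one]
  have ha' : ((1 : Ω) ^ 2 • fΩ.subst δ).a ≠ 0 := by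
    rw [smul_a, one_pow, one_mul, a_subst_eq_eval, R.eval_eq]
    refine mul_ne_zero (mul_ne_zero (mul_ne_zero (mul_ne_zero hfΩ'.a_ne ?_) ?_) ?_) ?_ <;>
      exact hδden _
  set R' := R.smulSubst (μ := (1 : Ω)) (γ := δ) ha' with hR'def
  have hR'r : R'.r = S'.r := funext fun k ↦ by rw [hR'def, RootData.smulSubst_r, hroot]
  -- Step 8: `g = κ · (γ' · f)` with `κ = a_g / a'`
  set a' := ((1 : Ω) ^ 2 • fΩ.subst δ).a with ha'def
  have hgf' : gΩ = (gΩ.a / a') • ((1 : Ω) ^ 2 • fΩ.subst δ) := by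
    have e1 : gΩ = ofRootVec gΩ.a S'.r := S'.eq_ofRoots
    have e2 : (1 : Ω) ^ 2 • fΩ.subst δ = ofRootVec a' S'.r := by
      have h := R'.eq_ofRoots
      rw [hR'r] at h
      exact h
    calc gΩ = ofRootVec gΩ.a S'.r := e1
      _ = ofRootVec ((gΩ.a / a') * a') S'.r := by rw [div_mul_cancel₀ _ ha']
      _ = (gΩ.a / a') • ofRootVec a' S'.r := ofRootVec_mul _ _ _
      _ = (gΩ.a / a') • ((1 : Ω) ^ 2 • fΩ.subst δ) := by rw [← e2]
  set κ : ℚ := g.a / ((1 : ℚ) ^ 2 • f.subst γ').a with hκdef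
  have hκ : ι κ = gΩ.a / a' := by
    rw [hκdef, map_div₀, ha'def, ← hmapf']; rfl
  have hgκ : g = κ • ((1 : ℚ) ^ 2 • f.subst γ') := by
    apply map_injective ι.injective
    rw [show (κ • ((1 : ℚ) ^ 2 • f.subst γ')).map ι = ι κ • ((1 : ℚ) ^ 2 • f.subst γ').map ι by
      ext <;> simp [BinaryQuartic.map], hκ, hmapf', ← hgf']
  -- Step 9: `κ` is a square: compare the labels of `g` and of `γ' · f`
  set t' : Ω := δ.det * ι tf with ht'def
  have hδdet : δ.det ≠ 0 := by
    rw [hδdef, show γ'.map ι = ι.mapMatrix γ' from rfl, ← RingHom.map_det]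
    exact (map_ne_zero ι).mpr hγ'det
  have ht' : t' ≠ 0 := mul_ne_zero hδdet hfΩ'.t_ne
  have htt : t' ^ 2 = (1 : Ω) ^ 2 * δ.det ^ 2 * ι tf ^ 2 := by rw [ht'def]; ring
  have hlabel' : ∀ k l, torsorPt C ((1 : Ω) ^ 2 • fΩ.subst δ) t' (S'.r k) (S'.r l) = Tf k l := by
    intro k l
    rw [← hroot k, ← hroot l]
    exact torsorPt_smul_subst R ha' h3 hfΩ'.t_ne one_ne_zero hδdet htt k l
  -- set-up data for the transformed form
  have hI' : ((1 : Ω) ^ 2 • fΩ.subst δ).I = -3 * ι (AB.1 : ℚ) * t' ^ 4 := by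
    rw [I_smul, I_subst, hfΩ'.I_eq, ht'def]; ring
  have hJ' : ((1 : Ω) ^ 2 • fΩ.subst δ).J = -27 * ι (AB.2 : ℚ) * t' ^ 6 := by
    rw [J_smul, J_subst, hfΩ'.J_eq, ht'def]; ring
  have hΔ' : ((1 : Ω) ^ 2 • fΩ.subst δ).disc ≠ 0 := by
    rw [R'.disc_eq, hR'r]
    refine mul_ne_zero (pow_ne_zero _ ha') (pow_ne_zero _ ?_)
    refine mul_ne_zero (mul_ne_zero (mul_ne_zero (mul_ne_zero (mul_ne_zero ?_ ?_) ?_) ?_) ?_) ?_ <;>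
      exact hdiff' (by decide)
  have hx : ∀ k : Fin 4, k ≠ 0 → phi gΩ (S'.r 0) (S'.r k) * (3 * t' ^ 2) =
      phi ((1 : Ω) ^ 2 • fΩ.subst δ) (S'.r 0) (S'.r k) * (3 * ι tg ^ 2) := by
    intro k hk
    have h := (hlabel 0 k).trans (hlabel' 0 k).symm
    rw [torsorPt_eq_some hC S' hgΩ'.a_ne h3 hΔg hgΩ'.t_ne hgΩ'.I_eq hgΩ'.J_eq hk.symm] at h
    have h' := torsX_eq_of_some_eq h
    rw [torsX, torsX, div_eq_div_iff htg2 (mul_ne_zero h3 (pow_ne_zero _ ht'))] at h'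
    linear_combination -h'
  have hphi_smul : ∀ u v, phi gΩ u v = ι κ * phi ((1 : Ω) ^ 2 • fΩ.subst δ) u v := by
    intro u v
    conv_lhs => rw [hgf']
    rw [phi_smul, hκ]
  have hκsq : ι κ * t' ^ 2 = ι tg ^ 2 := by
    -- one of `φ'(s'₀, s'₁)`, `φ'(s'₀, s'₂)` is nonzero
    have hne := R'.phi01_ne_phi02 ha' h3 hΔ'
    rw [hR'r] at hne
    by_cases h1 : phi ((1 : Ω) ^ 2 • fΩ.subst δ) (S'.r 0) (S'.r 1) = 0
    · have h2 : phi ((1 : Ω) ^ 2 • fΩ.subst δ) (S'.r 0) (S'.r 2) ≠ 0 := by rwa [h1, ne_comm] at hne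
      have h := hx 2 (by decide)
      rw [hphi_smul] at h
      have : phi ((1 : Ω) ^ 2 • fΩ.subst δ) (S'.r 0) (S'.r 2) * (3 * (ι κ * t' ^ 2 - ι tg ^ 2)) = 0 := by
        linear_combination h
      have := (mul_eq_zero.mp this).resolve_left h2
      exact sub_eq_zero.mp ((mul_eq_zero.mp this).resolve_left h3)
    · have h := hx 1 (by decide)
      rw [hphi_smul] at h
      have : phi ((1 : Ω) ^ 2 • fΩ.subst δ) (S'.r 0) (S'.r 1) * (3 * (ι κ * t' ^ 2 - ι tg ^ 2)) = 0 := by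
        linear_combination h
      have := (mul_eq_zero.mp this).resolve_left h1
      exact sub_eq_zero.mp ((mul_eq_zero.mp this).resolve_left h3)
  have hκval : κ = (tg / (γ'.det * tf)) ^ 2 := by
    have hdetι : ι γ'.det = δ.det := by
      rw [hδdef, show γ'.map ι = ι.mapMatrix γ' from rfl, ← RingHom.map_det]
    have key : ι κ = ι ((tg / (γ'.det * tf)) ^ 2) := by
      rw [map_pow, map_div₀ ι tg (γ'.det * tf), map_mul, hdetι, ← ht'def, div_pow,
        eq_div_iff (pow_ne_zero _ ht'), hκsq]
    exact ι.injective key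
  -- conclusion
  refine ⟨tg / (γ'.det * tf), div_ne_zero hg.t_ne (mul_ne_zero hγ'det hf.t_ne), γ', hγ'det, ?_⟩
  rw [hgκ, hκval, one_pow, one_smul]

end Main

/-! ## §6 Injectivity on `selmerFormSet` -/

section FormSet

variable {AB : ℤ × ℤ}

/-- **Injectivity of `f ↦ [f]` on `ℚ`-equivalence classes of `selmerFormSet AB`**: locally soluble
integral forms with the same Selmer element are `ℚ`-equivalent (main theorem applied to the
normalised representatives, composed with `f ⊗ ℚ ∼ normRep f`). Bhargava–Shankar, Lemma 5.2.
[cite: BhargavaShankarAnnals2015, Lemma 5.2 (arXiv:1006.1002v2 numbering)] -/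
theorem kEquiv_of_selmerClassOf_eq {f g : BinaryQuartic ℤ} (hf : f ∈ selmerFormSet AB)
    (hg : g ∈ selmerFormSet AB) (hE : 4 * AB.1 ^ 3 + 27 * AB.2 ^ 2 ≠ 0)
    (h : selmerClassOf hf hE = selmerClassOf hg hE) :
    KEquiv (f.map (Int.castRingHom ℚ)) (g.map (Int.castRingHom ℚ)) := by
  have hrep : KEquiv (normRep f) (normRep g) :=
    kEquiv_of_selmerClass_eq (setup_normRep hf hE) (setup_normRep hg hE) (eval_rootOf hf hE)
      (eval_rootOf hg hE) h
  exact kEquiv_trans (kEquiv_normRep f) (kEquiv_trans hrep (kEquiv_symm (kEquiv_normRep g)))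

end FormSet

end TwoCovering

end Literature.NumberTheory.EllipticCurves
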